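import Mathlib
import HarnessLib
import Summits.HubbardSuperconductivity.HubbardSuperconductivity.Theorems.KLProgrammePerturbedFermiCurveTower
import Summits.HubbardSuperconductivity.HubbardSuperconductivity.Theorems.KLProgrammeKLRegimeSplitTwoLegThresholdsExplicit

/-!
# Route `KLProgramme` — K3 engine child (stmt-HubbardSuperconductivity-19918, `stub_twoLeg_step`, clause (E3a-MS) `TwoLegSizesMST`):
# NUMERALS for the Fermi-curve tower constants `klCurve*`

Cell `gate-hubbard-kl`, seat hubbard-kl-k3c3-p3 (g3) «implicit-function / monotonicity route for μ(n)», (P2) of the (L)+(F) recipe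
(k3c3-p1 MS-DESIGN-NOTE §3; plan g12 ruling STATUS l.1769).  The tower / curve constants of `…PerturbedFermiCurveExplicit` and
`…PerturbedFermiCurveTower` are closed-form expressions in `π√2` and `klCurveD = Dt_min(−1.1, −0.1)/2`; with p1b's numeral
`cDtmin_window_ge : 33/100 ≤ Dt_min(−1.1, −0.1)` (`…TwoLegThresholdsExplicit`) they become NUMBERS, which is what every budget
comparison of the two-leg assembly (P4) finally needs.  All bounds are upper bounds by explicit numerals (rounded up, margins ≥ 0.4 %):

* `pi_mul_sqrt_two_le : π√2 ≤ 4.45`, `klCurveD_ge : 33/200 ≤ klCurveD`, `inv_klCurveD_le : 1/klCurveD ≤ 200/33`;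
* `klCurveR1_le : R1 ≤ 111`, `klCurveK1_le : K1 ≤ 116`, `klCurveR2_le : R2 ≤ 349 000`, `klCurveK2_le : K2 ≤ 350 000`;
* `klCurveB3_le : B3 ≤ 7.6·10⁷`, `klCurveT3_le : T3(A₃) ≤ 3.2·10⁹ + 7.6·10⁷·A₃`, `klCurveG4_le : G4 ≤ 1.8·10¹⁰`, `klCurveB4_le : B4 ≤ 2.3·10¹²`,
  `klCurveT4_le : T4(A₃,A₄) ≤ 4.9·10¹³ + 2.3·10¹²·A₃ + 1.8·10¹⁰·A₄`;
* curve sizes `klCurveD1_le : D1 ≤ 231`, `klCurveD2_le : D2 ≤ 7·10⁵`, `klCurveD3_le : D3(A₃) ≤ 6.5·10⁹ + 1.6·10⁸·A₃`,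
  `klCurveD4_le : D4(A₃,A₄) ≤ 9.9·10¹³ + 4.7·10¹²·A₃ + 3.6·10¹⁰·A₄`.

(The sizes are large because the order-1 majorant `R1 = (4 + 1/10)π√2/klCurveD` is raised to the fourth power at order 4; they are
honest consequences of the landed tower, not artefacts of rounding.)  Everything is PROVED (`norm_num`/`nlinarith` on the closed forms);
no definitions, no named facts. [folklore]
-/

noncomputable section

namespace Summit.HubbardSuperconductivity.HubbardSuperconductivity.Theorems.PerturbedFermiCurve

set_option linter.dupNamespace false -- summit = problem name (single-conjunct summit), D-0017

open Real
open Literature.MathematicalPhysics.QuantumLattice Literature.MathematicalPhysics.QuantumLattice.BandSectorCounting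
open Summit.HubbardSuperconductivity.HubbardSuperconductivity.Theorems.KLRegimeSplit

/-! ## §1 The two atoms: `π√2` and `klCurveD` -/

/-- `π√2 ≤ 4.45` (`π < 3.1416`, `√2 < 1.41422`). [folklore] -/
theorem pi_mul_sqrt_two_le : π * Real.sqrt 2 ≤ 4.45 := by
  have hπ := Real.pi_lt_d4
  have h2 : Real.sqrt 2 < 1.41422 := by
    rw [Real.sqrt_lt' (by norm_num)]; norm_num
  nlinarith [Real.pi_pos, Real.sqrt_nonneg 2]

/-- `0 ≤ π√2`. [folklore] -/
theorem pi_mul_sqrt_two_nonneg : 0 ≤ π * Real.sqrt 2 := by positivity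

/-- `klCurveD = Dt_min(−1.1,−0.1)/2 ≥ 33/200` (p1b's `cDtmin_window_ge`). [folklore] -/
theorem klCurveD_ge : (33 : ℝ) / 200 ≤ klCurveD := by
  unfold klCurveD; linarith [cDtmin_window_ge]

/-- `1/klCurveD ≤ 200/33`. [folklore] -/
theorem inv_klCurveD_le : 1 / klCurveD ≤ 200 / 33 := by
  rw [div_le_div_iff₀ klCurveD_pos (by norm_num)]; linarith [klCurveD_ge]

/-! ## §2 The radius-tower constants -/

/-- `R1 ≤ 111`. [folklore] -/
theorem klCurveR1_le : klCurveR1 ≤ 111 := by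
  unfold klCurveR1
  rw [div_le_iff₀ klCurveD_pos]
  nlinarith [pi_mul_sqrt_two_le, klCurveD_ge]

/-- `K1 = R1 + π√2 ≤ 116`. [folklore] -/
theorem klCurveK1_le : klCurveK1 ≤ 116 := by
  unfold klCurveK1; linarith [klCurveR1_le, pi_mul_sqrt_two_le]

/-- `0 ≤ K1`. [folklore] -/
theorem klCurveK1_nonneg : 0 ≤ klCurveK1 := by
  unfold klCurveK1; linarith [klCurveR1_nonneg, pi_mul_sqrt_two_nonneg]

/-- `R2 ≤ 349 000`. [folklore] -/
theorem klCurveR2_le : klCurveR2 ≤ 349000 := by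
  have hK := klCurveK1_le
  have hK0 := klCurveK1_nonneg
  have hsq : klCurveK1 ^ 2 ≤ 116 ^ 2 := pow_le_pow_left₀ hK0 hK 2
  unfold klCurveR2
  rw [div_le_iff₀ klCurveD_pos, show klCurveR1 + π * Real.sqrt 2 = klCurveK1 from rfl]
  nlinarith [pi_mul_sqrt_two_le, klCurveD_ge, klCurveR1_le, klCurveR1_nonneg, pi_mul_sqrt_two_nonneg]

/-- `K2 = R2 + 2R1 + π√2 ≤ 350 000`. [folklore] -/
theorem klCurveK2_le : klCurveK2 ≤ 350000 := by
  unfold klCurveK2; linarith [klCurveR2_le, klCurveR1_le, pi_mul_sqrt_two_le]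

/-- `0 ≤ K2`. [folklore] -/
theorem klCurveK2_nonneg : 0 ≤ klCurveK2 := by
  unfold klCurveK2; linarith [klCurveR2_nonneg, klCurveR1_nonneg, pi_mul_sqrt_two_nonneg]

/-- `B3 = 8K1³/klCurveD ≤ 7.6·10⁷`. [folklore] -/
theorem klCurveB3_le : klCurveB3 ≤ 76000000 := by
  have h3 : klCurveK1 ^ 3 ≤ 116 ^ 3 := pow_le_pow_left₀ klCurveK1_nonneg klCurveK1_le 3
  unfold klCurveB3
  rw [div_le_iff₀ klCurveD_pos]
  nlinarith [klCurveD_ge]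

/-- `0 ≤ B3`. [folklore] -/
theorem klCurveB3_nonneg : 0 ≤ klCurveB3 := by
  have := klCurveD_pos; have := klCurveK1_nonneg; unfold klCurveB3; positivity

/-- **`T3(A₃) ≤ 3.2·10⁹ + 7.6·10⁷·A₃`** for `A₃ ≥ 0`. [folklore] -/
theorem klCurveT3_le {A₃ : ℝ} (hA₃ : 0 ≤ A₃) : klCurveT3 A₃ ≤ 3200000000 + 76000000 * A₃ := by
  have hK1 := klCurveK1_le
  have hK10 := klCurveK1_nonneg
  have hK2 := klCurveK2_le
  have hK20 := klCurveK2_nonneg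
  have h3 : klCurveK1 ^ 3 ≤ 116 ^ 3 := pow_le_pow_left₀ hK10 hK1 3
  have h12 : klCurveK1 * klCurveK2 ≤ 116 * 350000 := mul_le_mul hK1 hK2 hK20 (by norm_num)
  have hA3 : A₃ * klCurveK1 ^ 3 ≤ A₃ * 116 ^ 3 := mul_le_mul_of_nonneg_left h3 hA₃
  have hd : (3200000000 + 76000000 * A₃) * (33 / 200) ≤ (3200000000 + 76000000 * A₃) * klCurveD :=
    mul_le_mul_of_nonneg_left klCurveD_ge (by positivity)
  unfold klCurveT3
  rw [div_le_iff₀ klCurveD_pos, show klCurveR1 + π * Real.sqrt 2 = klCurveK1 from rfl,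
    show klCurveR2 + 2 * klCurveR1 + π * Real.sqrt 2 = klCurveK2 from rfl]
  nlinarith [pi_mul_sqrt_two_le, klCurveR1_le, klCurveR2_le, klCurveR1_nonneg, klCurveR2_nonneg, pi_mul_sqrt_two_nonneg]

/-- `G4 = 16K1⁴/klCurveD ≤ 1.8·10¹⁰`. [folklore] -/
theorem klCurveG4_le : klCurveG4 ≤ 18000000000 := by
  have h4 : klCurveK1 ^ 4 ≤ 116 ^ 4 := pow_le_pow_left₀ klCurveK1_nonneg klCurveK1_le 4
  unfold klCurveG4
  rw [div_le_iff₀ klCurveD_pos]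
  nlinarith [klCurveD_ge]

/-- `0 ≤ G4`. [folklore] -/
theorem klCurveG4_nonneg : 0 ≤ klCurveG4 := by
  have := klCurveD_pos; have := klCurveK1_nonneg; unfold klCurveG4; positivity

/-- `B4 ≤ 2.3·10¹²`. [folklore] -/
theorem klCurveB4_le : klCurveB4 ≤ 2300000000000 := by
  have hK1 := klCurveK1_le
  have hK10 := klCurveK1_nonneg
  have hsq : klCurveK1 ^ 2 ≤ 116 ^ 2 := pow_le_pow_left₀ hK10 hK1 2
  have h12 : klCurveK1 ^ 2 * klCurveK2 ≤ 116 ^ 2 * 350000 := mul_le_mul hsq klCurveK2_le klCurveK2_nonneg (by norm_num)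
  have hB := klCurveB3_le
  have hB0 := klCurveB3_nonneg
  have h1B : klCurveK1 * klCurveB3 ≤ 116 * 76000000 := mul_le_mul hK1 hB hB0 (by norm_num)
  unfold klCurveB4
  rw [div_le_iff₀ klCurveD_pos]
  nlinarith [klCurveD_ge]

/-- `0 ≤ B4`. [folklore] -/
theorem klCurveB4_nonneg : 0 ≤ klCurveB4 := by
  have := klCurveD_pos; have := klCurveK1_nonneg; have := klCurveK2_nonneg; have := klCurveB3_nonneg
  unfold klCurveB4; positivity

/-- **`T4(A₃, A₄) ≤ 4.9·10¹³ + 2.3·10¹²·A₃ + 1.8·10¹⁰·A₄`** for `A₃, A₄ ≥ 0` (via the affine form `T4 = T4(0,0) + B4·A₃ + G4·A₄`). [folklore] -/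
theorem klCurveT4_le {A₃ A₄ : ℝ} (hA₃ : 0 ≤ A₃) (hA₄ : 0 ≤ A₄) :
    klCurveT4 A₃ A₄ ≤ 49000000000000 + 2300000000000 * A₃ + 18000000000 * A₄ := by
  have h00 : klCurveT4 0 0 ≤ 49000000000000 := by
    have hK1 := klCurveK1_le
    have hK10 := klCurveK1_nonneg
    have hK2 := klCurveK2_le
    have hK20 := klCurveK2_nonneg
    have h4 : klCurveK1 ^ 4 ≤ 116 ^ 4 := pow_le_pow_left₀ hK10 hK1 4
    have hsq : klCurveK1 ^ 2 ≤ 116 ^ 2 := pow_le_pow_left₀ hK10 hK1 2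
    have h12 : klCurveK1 ^ 2 * klCurveK2 ≤ 116 ^ 2 * 350000 := mul_le_mul hsq hK2 hK20 (by norm_num)
    have h22 : klCurveK2 ^ 2 ≤ 350000 ^ 2 := pow_le_pow_left₀ hK20 hK2 2
    have hT3 : klCurveT3 0 ≤ 3200000000 := by simpa using klCurveT3_le le_rfl
    have hT30 : 0 ≤ klCurveT3 0 := klCurveT3_nonneg le_rfl
    have h1T : klCurveK1 * (klCurveT3 0 + 3 * klCurveR2 + 3 * klCurveR1 + π * Real.sqrt 2) ≤
        116 * (3200000000 + 3 * 349000 + 3 * 111 + 4.45) :=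
      mul_le_mul hK1 (by linarith [klCurveR2_le, klCurveR1_le, pi_mul_sqrt_two_le])
        (by linarith [klCurveR2_nonneg, klCurveR1_nonneg, pi_mul_sqrt_two_nonneg]) (by norm_num)
    unfold klCurveT4
    rw [div_le_iff₀ klCurveD_pos, show klCurveR1 + π * Real.sqrt 2 = klCurveK1 from rfl,
      show klCurveR2 + 2 * klCurveR1 + π * Real.sqrt 2 = klCurveK2 from rfl]
    nlinarith [klCurveD_ge, pi_mul_sqrt_two_le, klCurveR1_le, klCurveR2_le, klCurveR1_nonneg, klCurveR2_nonneg,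
      pi_mul_sqrt_two_nonneg]
  rw [klCurveT4_affine A₃ A₄]
  have h1 : klCurveB4 * A₃ ≤ 2300000000000 * A₃ := mul_le_mul_of_nonneg_right klCurveB4_le hA₃
  have h2 : klCurveG4 * A₄ ≤ 18000000000 * A₄ := mul_le_mul_of_nonneg_right klCurveG4_le hA₄
  linarith

/-- `0 ≤ T4(A₃, A₄)` for `A₃, A₄ ≥ 0`. [folklore] -/
theorem klCurveT4_nonneg {A₃ A₄ : ℝ} (hA₃ : 0 ≤ A₃) (hA₄ : 0 ≤ A₄) : 0 ≤ klCurveT4 A₃ A₄ := by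
  have := klCurveD_pos; have := klCurveR1_nonneg; have := klCurveR2_nonneg; have := klCurveT3_nonneg hA₃
  have := pi_mul_sqrt_two_nonneg
  unfold klCurveT4; positivity

/-! ## §3 The curve sizes -/

/-- `D1 ≤ 231`. [folklore] -/
theorem klCurveD1_le : klCurveD1 ≤ 231 := by
  unfold klCurveD1; linarith [klCurveR1_le, pi_mul_sqrt_two_le]

/-- `D2 ≤ 7·10⁵`. [folklore] -/
theorem klCurveD2_le : klCurveD2 ≤ 700000 := by
  unfold klCurveD2; linarith [klCurveR1_le, klCurveR2_le, pi_mul_sqrt_two_le]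

/-- **`D3(A₃) ≤ 6.5·10⁹ + 1.6·10⁸·A₃`** for `A₃ ≥ 0`. [folklore] -/
theorem klCurveD3_le {A₃ : ℝ} (hA₃ : 0 ≤ A₃) : klCurveD3 A₃ ≤ 6500000000 + 160000000 * A₃ := by
  unfold klCurveD3; linarith [klCurveR1_le, klCurveR2_le, pi_mul_sqrt_two_le, klCurveT3_le hA₃]

/-- **`D4(A₃, A₄) ≤ 9.9·10¹³ + 4.7·10¹²·A₃ + 3.6·10¹⁰·A₄`** for `A₃, A₄ ≥ 0`. [folklore] -/
theorem klCurveD4_le {A₃ A₄ : ℝ} (hA₃ : 0 ≤ A₃) (hA₄ : 0 ≤ A₄) :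
    klCurveD4 A₃ A₄ ≤ 99000000000000 + 4700000000000 * A₃ + 36000000000 * A₄ := by
  unfold klCurveD4
  linarith [klCurveR1_le, klCurveR2_le, pi_mul_sqrt_two_le, klCurveT3_le hA₃, klCurveT4_le hA₃ hA₄]

/-- Nonnegativity of the curve sizes: `0 ≤ D1`, `0 ≤ D2`, `0 ≤ D3(A₃)`, `0 ≤ D4(A₃,A₄)` (`A₃, A₄ ≥ 0`). [folklore] -/
theorem klCurveD_sizes_nonneg {A₃ A₄ : ℝ} (hA₃ : 0 ≤ A₃) (hA₄ : 0 ≤ A₄) :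
    0 ≤ klCurveD1 ∧ 0 ≤ klCurveD2 ∧ 0 ≤ klCurveD3 A₃ ∧ 0 ≤ klCurveD4 A₃ A₄ := by
  have := klCurveR1_nonneg; have := klCurveR2_nonneg; have := klCurveT3_nonneg hA₃; have := klCurveT4_nonneg hA₃ hA₄
  have := pi_mul_sqrt_two_nonneg
  unfold klCurveD1 klCurveD2 klCurveD3 klCurveD4
  exact ⟨by positivity, by positivity, by positivity, by positivity⟩

end Summit.HubbardSuperconductivity.HubbardSuperconductivity.Theorems.PerturbedFermiCurve

end
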